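import Mathlib
import HarnessLib
import Summits.ValiantsHypothesis.ValiantsHypothesis.Theorems.LacunarySymmetroidMatrixDescartesOsculationLawPeelEndMultiplicity

/-!
# ValiantsHypothesis / LacunarySymmetroid — crux `MatrixDescartes` (stmt-ValiantsHypothesis-18050, V1),
# line `Cruxes/MatrixDescartes/Lines/osculation_law.lean` («osculation-law»), stub `stub_peel` (ALL ranks):
# A BRANCH WITH A FINITE POSITIVE END-LIMIT EXTENDS (rank-free; the extension step of piece (α) of
# NOTE-p7g12-peel-general-r-sizing.md)

For a hyperbolic family in general position with finite osculation set: if a continuous solution `b = β(t)` of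
`Φ(t, b) = 0` on `(α, ω)`, `ω > 0`, has a limit `b* > 0` as `t → ω⁻`, then `(ω, b*)` is a curve point, the local implicit
branch `ψ` there (`…PeelLocalBranch`) coincides with `β` just left of `ω` (local uniqueness), and glueing gives a continuous
solution on `(α, ω + δ)` extending `β`, positive on `[ω, ω + δ)`.  Consequently a MAXIMAL branch cannot end at a finite
positive limit: its ends are `t → 0⁺/∞`, `b → 0` (zero of `blockDet`) or `b → ∞` (zero of `lowerDet`) — or oscillation,
excluded separately by the vanishing-fibre lemma.

* `eval_eq_zero_of_tendsto` — closedness: `Φ(t, β t) = 0` on `(α, ω)` and `β → b*` at `ω⁻` ⇒ `Φ(ω, b*) = 0`.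
* **`exists_extension_of_tendsto`** — the extension past `ω`.

Honest framing: a rank-free LEMMA toward the OPEN stub `stub_peel` (all `r`); nothing of the summit is proved; `VP ≠ VNP` is
NOT proved.  No definitions, no named facts.
-/

-- `Summit.ValiantsHypothesis.ValiantsHypothesis.…` is the tree's mandated single-conjunct layout (Sub = Summit).
set_option linter.dupNamespace false

noncomputable section

namespace Summit.ValiantsHypothesis.ValiantsHypothesis.Theorems.LacunarySymmetroidMatrixDescartes

open Polynomial Set Filter
open MvPolynomial (pderiv)
open scoped BigOperators Topology

namespace OsculationPeel

/-- **Closedness of the curve along a branch**: `Φ(t, β t) = 0` on `(α, ω)` and `β → b*` as `t → ω⁻` give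
`Φ(ω, b*) = 0`. [folklore] -/
theorem eval_eq_zero_of_tendsto (Φ : MvPolynomial (Fin 2) ℝ) {α ω bstar : ℝ} {β : ℝ → ℝ} (hαω : α < ω)
    (hsol : ∀ t ∈ Ioo α ω, MvPolynomial.eval ![t, β t] Φ = 0) (hlim : Tendsto β (𝓝[<] ω) (𝓝 bstar)) :
    MvPolynomial.eval ![ω, bstar] Φ = 0 := by
  have hid : Tendsto (fun u : ℝ => u) (𝓝[<] ω) (𝓝 ω) := tendsto_id.mono_left nhdsWithin_le_nhds
  have hcont := ((continuous_eval₂ Φ).tendsto (ω, bstar)).comp (hid.prodMk_nhds hlim)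
  have hev : ∀ᶠ u in 𝓝[<] ω, MvPolynomial.eval ![u, β u] Φ = 0 :=
    mem_of_superset (Ioo_mem_nhdsLT hαω) fun u hu => hsol u hu
  have h0 : Tendsto (fun u => MvPolynomial.eval ![u, β u] Φ) (𝓝[<] ω) (𝓝 0) :=
    tendsto_const_nhds.congr' (hev.mono fun u hu => hu.symm)
  exact tendsto_nhds_unique hcont h0

/-- **A branch with a finite positive end-limit extends.**  Hyperbolic vertical family, finite osculation set, GP; a
continuous solution `β` on `(α, ω)` (`ω > 0`) with `β → b* > 0` as `t → ω⁻` extends to a continuous solution on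
`(α, ω + δ)`, equal to `b*` at `ω` and positive on `[ω, ω + δ)`. [folklore] -/
theorem exists_extension_of_tendsto (Φ : MvPolynomial (Fin 2) ℝ) (P : ℝ → ℝ[X])
    (hP : ∀ t b, (P t).eval b = MvPolynomial.eval ![t, b] Φ) (hsplit : ∀ t, 0 < t → (P t).Splits)
    (hfin : {p : Fin 2 → ℝ | 0 < p 0 ∧ 0 < p 1 ∧ MvPolynomial.eval p Φ = 0 ∧
      MvPolynomial.eval p
        (MvPolynomial.X 0 * MvPolynomial.pderiv 0 (MvPolynomial.X 0 * MvPolynomial.pderiv 0 Φ)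
            * (MvPolynomial.X 1 * MvPolynomial.pderiv 1 Φ) ^ 2
          - 2 * (MvPolynomial.X 0 * MvPolynomial.pderiv 0 (MvPolynomial.X 1 * MvPolynomial.pderiv 1 Φ))
            * (MvPolynomial.X 0 * MvPolynomial.pderiv 0 Φ) * (MvPolynomial.X 1 * MvPolynomial.pderiv 1 Φ)
          + MvPolynomial.X 1 * MvPolynomial.pderiv 1 (MvPolynomial.X 1 * MvPolynomial.pderiv 1 Φ)
            * (MvPolynomial.X 0 * MvPolynomial.pderiv 0 Φ) ^ 2) = 0}.Finite)
    (hgp : ∀ p ∈ {p : Fin 2 → ℝ | 0 < p 0 ∧ 0 < p 1 ∧ MvPolynomial.eval p Φ = 0 ∧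
      MvPolynomial.eval p
        (MvPolynomial.X 0 * MvPolynomial.pderiv 0 (MvPolynomial.X 0 * MvPolynomial.pderiv 0 Φ)
            * (MvPolynomial.X 1 * MvPolynomial.pderiv 1 Φ) ^ 2
          - 2 * (MvPolynomial.X 0 * MvPolynomial.pderiv 0 (MvPolynomial.X 1 * MvPolynomial.pderiv 1 Φ))
            * (MvPolynomial.X 0 * MvPolynomial.pderiv 0 Φ) * (MvPolynomial.X 1 * MvPolynomial.pderiv 1 Φ)
          + MvPolynomial.X 1 * MvPolynomial.pderiv 1 (MvPolynomial.X 1 * MvPolynomial.pderiv 1 Φ)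
            * (MvPolynomial.X 0 * MvPolynomial.pderiv 0 Φ) ^ 2) = 0},
        MvPolynomial.eval p (MvPolynomial.pderiv 1 Φ) ≠ 0)
    {α ω bstar : ℝ} {β : ℝ → ℝ} (hω : 0 < ω) (hαω : α < ω) (hb : 0 < bstar)
    (hcont : ContinuousOn β (Ioo α ω)) (hsol : ∀ t ∈ Ioo α ω, MvPolynomial.eval ![t, β t] Φ = 0)
    (hlim : Tendsto β (𝓝[<] ω) (𝓝 bstar)) :
    ∃ δ > 0, ∃ β' : ℝ → ℝ, (∀ t ∈ Ioo α ω, β' t = β t) ∧ β' ω = bstar ∧ ContinuousOn β' (Ioo α (ω + δ)) ∧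
      (∀ t ∈ Ioo α (ω + δ), MvPolynomial.eval ![t, β' t] Φ = 0) ∧ ∀ t ∈ Ico ω (ω + δ), 0 < β' t := by
  have hΦ : MvPolynomial.eval ![ω, bstar] Φ = 0 := eval_eq_zero_of_tendsto Φ hαω hsol hlim
  obtain ⟨ψ, hψω, hψcd, hψsol, hU⟩ := exists_local_branch_of_hyperbolic Φ P hP hsplit hfin hgp hω hb hΦ
  -- `ψ` is continuous, a solution, and positive on a neighbourhood of `ω`
  have hψca : ∀ᶠ t in 𝓝 ω, ContinuousAt ψ t :=
    (hψcd.eventually (by simp)).mono fun t ht => ht.continuousAt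
  have hψpos : ∀ᶠ t in 𝓝 ω, 0 < ψ t := by
    have h := hψcd.continuousAt.tendsto
    rw [hψω] at h
    exact h.eventually (Ioi_mem_nhds hb)
  obtain ⟨δ₁, hδ₁, h₁⟩ : ∃ δ₁ > 0, ∀ t, dist t ω < δ₁ →
      ContinuousAt ψ t ∧ MvPolynomial.eval ![t, ψ t] Φ = 0 ∧ 0 < ψ t :=
    Metric.eventually_nhds_iff.1 ((hψca.and hψsol).and hψpos |>.mono fun t h => ⟨h.1.1, h.1.2, h.2⟩)
  -- local uniqueness: `β = ψ` just left of `ω`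
  have hid : Tendsto (fun u : ℝ => u) (𝓝[<] ω) (𝓝 ω) := tendsto_id.mono_left nhdsWithin_le_nhds
  have hU' := (hid.prodMk_nhds hlim).eventually hU
  have hev : ∀ᶠ u in 𝓝[<] ω, MvPolynomial.eval ![u, β u] Φ = 0 :=
    mem_of_superset (Ioo_mem_nhdsLT hαω) fun u hu => hsol u hu
  have heq : ∀ᶠ u in 𝓝[<] ω, β u = ψ u := by
    filter_upwards [hU', hev] with u hu hu0
    exact (hu.1 hu0).symm
  obtain ⟨l, hl, hlsub⟩ := mem_nhdsLT_iff_exists_Ioo_subset.1 heq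
  -- the glued function
  refine ⟨δ₁, hδ₁, fun t => if t < ω then β t else ψ t, fun t ht => by simp [ht.2], by simp [hψω], ?_, ?_, ?_⟩
  · -- continuity on `(α, ω + δ₁)`
    intro t ht
    refine ContinuousAt.continuousWithinAt ?_
    by_cases htω : t < ω
    · -- left of `ω`: locally `β`
      have hβt : ContinuousAt β t := (hcont t ⟨ht.1, htω⟩).continuousAt (Ioo_mem_nhds ht.1 htω)
      refine hβt.congr ?_
      filter_upwards [Iio_mem_nhds htω] with u hu
      simp [show u < ω from hu]
    · -- at / right of `ω`: locally `ψ` (on `(l, ω + δ₁)` the glued function IS `ψ`)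
      push Not at htω
      have hψt : ContinuousAt ψ t := (h₁ t (by rw [Real.dist_eq, abs_lt]; constructor <;> linarith [ht.2])).1
      refine hψt.congr ?_
      have hnhds : Ioo (max l (ω - δ₁)) (ω + δ₁) ∈ 𝓝 t :=
        Ioo_mem_nhds (max_lt (hl.trans_le htω) (by linarith)) ht.2
      filter_upwards [hnhds] with u hu
      by_cases huω : u < ω
      · have : β u = ψ u := hlsub ⟨(le_max_left _ _).trans_lt hu.1, huω⟩
        simp [huω, this]
      · simp [huω]
  · -- solution on `(α, ω + δ₁)`
    intro t ht
    by_cases htω : t < ω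
    · simp only [htω, if_true]; exact hsol t ⟨ht.1, htω⟩
    · simp only [htω, if_false]
      push Not at htω
      exact (h₁ t (by rw [Real.dist_eq, abs_lt]; constructor <;> linarith [ht.2])).2.1
  · -- positivity on `[ω, ω + δ₁)`
    intro t ht
    have htω : ¬ t < ω := not_lt.2 ht.1
    simp only [htω, if_false]
    exact (h₁ t (by rw [Real.dist_eq, abs_lt]; constructor <;> linarith [ht.1, ht.2])).2.2

end OsculationPeel

end Summit.ValiantsHypothesis.ValiantsHypothesis.Theorems.LacunarySymmetroidMatrixDescartes

end
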